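import Summits.CriticalPhenomena.Ising3DConformalLimit.Theorems.EnergyNotSigmaSquaredGapForcesFarMergingSandwichDefs
import Summits.CriticalPhenomena.Ising3DConformalLimit.Theorems.IsingEuclidUpgradeR4NonGaussianFatStep
import Literature.Probability.LatticeModels.SourcedDoubleCurrentsSwitching
import Literature.Probability.LatticeModels.SourcedDoubleCurrentsOneArmMoments
import Literature.Probability.LatticeModels.CurrentsDisentangling
import Literature.Probability.LatticeModels.WeightedCurrentsDictionary
import Literature.Probability.LatticeModels.RandomCurrentsProofs
import Literature.Probability.LatticeModels.CurrentsTraceLaw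
import Literature.Probability.Percolation.PercolationProofs
import Literature.Probability.Percolation.PercolationEvents
import HarnessLib

/-!
# Dictionary between the currencies of the line `one-cluster-depletion-sandwich` (crux `GapForcesFarMerging`,
# stmt-CriticalPhenomena-4468) and the current vocabulary of the sibling crux `IsingEuclidUpgradeR4NonGaussian`
# (stmt-CriticalPhenomena-0636), for the stub `stub_fourToTwoMerging : FarHitIO → FarMergeIO`

Both lines read the same two finite-volume objects of Aizenman–Duminil-Copin 2021 (arXiv:1912.07973) §3 in the
free box `Λ_n ⊂ ℤ³` at `β_c(3)`:
* the TWO-CURRENT MERGING probability `P^{y₀y₁,y₂y₃}_{Λ_n}[y₀ ↔ y₂ in n₁+n₂]` of (3.11) — our `merge n y`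
  (`…GapForcesFarMergingSandwichDefs`), their `twoCurrentMeet n y₀ y₁ y₂ y₃` (`…IsingEuclidUpgradeR4NonGaussianDefs`);
* the FOUR-CURRENT (duplicated) MEETING probability of (3.13) — our `meet n y = P^{y₀y₁,∅} ⊗ P^{y₂y₃,∅}[the traced
  clusters C_{n₁+n₂}(y₀), C_{n₃+n₄}(y₂) share a vertex]`, read on the pair of lifted traces (`fourTraceLaw`), versus
  their `fourCurrentMeet n y₀ y₁ y₂ y₃ = P ⊗ P[y₀ ↔ y₂ in the union of the four traces]` (`FourMeet`), read on the four
  currents (`fourCurrentLaw`).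

Proved here (bookkeeping, one monotonicity and one transported tree inequality; nothing is posited):
* `merge_eq_twoCurrentMeet` : `merge n y = twoCurrentMeet n (y 0) (y 1) (y 2) (y 3)` (`rfl`: the events
  `{ω | y₂ ∈ C_ω(y₀)}` and `openConn y₀ y₂` are both `{ω | (openGraph ω).Reachable y₀ y₂}`);
* `fourTraceLaw_eq_map` : `fourTraceLaw n y` IS the push-forward of `fourCurrentLaw n y₀ y₁ y₂ y₃` under
  `Prod.map (sourcedTrace 3 n) (sourcedTrace 3 n)` (`sourcedDoubleCurrentLaw` is a `map` by definition,
  `Measure.map_prod_map`);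
* `preimage_meet_subset_fourMeet` (a shared vertex `u` of the two lifted traced clusters joins
  `y₀` to `y₂` in the union of the traces), hence
* `meet_le_fourCurrentMeet` : `meet n y ≤ fourCurrentMeet n (y 0) (y 1) (y 2) (y 3)` for ALL `n`, `y`;
* `meet_le_one`, and the registered helper `fourToTwo_dictionary` (conjunction of the displayed relations);
* the box form of ADC21 (3.13) itself, `merge_le_meet_of_mem_box_succ` : `merge n y ≤ meet n y` for `y₀,…,y₃ ∈ Λ_{n+1}`
  (for `yᵢ ∈ Λ_n` use `box_subset_box_succ`), registered as `merge_le_meet_box` — the tree's un-normalised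
  current-sum inequality `Current.tsum_inter_pair_mul_sq_le_four` (`CurrentsDisentangling.lean`) divided by
  `Z[y₀y₁] Z[y₂y₃] Z[∅]²` (`doubleCurrentMeasure_tracedConn_le_prod`, any finite graph); hence the CONVERSE of the
  stub, `farHitIO_of_farMergeIO : FarMergeIO → FarHitIO` (registered), is a theorem — the stub `stub_fourToTwoMerging`
  is the REVERSE (single-versus-duplicated fatness) implication, open since Aizenman 1982.

Consequence for the two cruxes (analysis, not formalised here): a lattice MEETING-ROBUSTNESS bound of ratio form
`c · meet n (L•y) ≤ merge n (L•y)` (eventually in `L`, `n`) is WEAKER, configuration by configuration, than 0636's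
`c · fourCurrentMeet ≤ twoCurrentMeet`, and closes `stub_fourToTwoMerging` with the same shape `y`.

References: M. Aizenman, H. Duminil-Copin, Ann. of Math. 194 (2021) = arXiv:1912.07973, §3.1–3.2, (3.11), (3.13);
M. Aizenman, Comm. Math. Phys. 86 (1982) §3, §5.
-/

noncomputable section

namespace Summit.CriticalPhenomena.Ising3DConformalLimit.EnergyNotSigmaSquaredGapForcesFarMergingSandwich

namespace FourToTwoProof

open scoped symmDiff ENNReal
open MeasureTheory Filter
open Literature.Probability.LatticeModels Literature.Probability.Percolation
open Summit.CriticalPhenomena.Ising3DConformalLimit.GapForcesFarMergingSandwich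
open Summit.CriticalPhenomena.Ising3DConformalLimit.Theses.EnergyNotSigmaSquared
open Summit.CriticalPhenomena.Ising3DConformalLimit.Cruxes.IsingEuclidUpgradeR4NonGaussian.FreeCovarianceDeltaDichotomy

/-! ## The two-current side: `merge = twoCurrentMeet` -/

/-- **`merge = P²`**: the line's two-current merging probability is the sibling crux's `twoCurrentMeet`, definitionally
(`βc = criticalBeta 3`; `{ω | y₂ ∈ openCluster ω y₀} = openConn y₀ y₂` since both unfold to
`(openGraph ω).Reachable y₀ y₂`). [cite: AizenmanDuminilCopinAnnals2021, eq. (3.11)] -/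
theorem merge_eq_twoCurrentMeet (n : ℕ) (y : Fin 4 → Site 3) :
    merge n y = twoCurrentMeet n (y 0) (y 1) (y 2) (y 3) := rfl

/-! ## The four-current side: `fourTraceLaw` is the push-forward of `fourCurrentLaw` -/

/-- A double-current measure is s-finite (a countable sum of finite multiples of Dirac masses). [folklore] -/
theorem sFinite_doubleCurrentMeasure {V : Type*} [Fintype V] [DecidableEq V] (G : SimpleGraph V)
    [DecidableRel G.Adj] (β : ℝ) (A B : Finset V) : SFinite (doubleCurrentMeasure G β A B) := by
  unfold doubleCurrentMeasure
  infer_instance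

/-- A double-current measure with `β ≥ 0` is a finite measure (it is the zero measure or a probability measure,
`doubleCurrentMeasure_zero_or_prob` of the sibling crux's fat-step file). [cite: DuminilCopin2016, §2.2] -/
theorem isFiniteMeasure_doubleCurrentMeasure {V : Type*} [Fintype V] [DecidableEq V] (G : SimpleGraph V)
    [DecidableRel G.Adj] {β : ℝ} (hβ : 0 ≤ β) (A B : Finset V) :
    IsFiniteMeasure (doubleCurrentMeasure G β A B) := by
  rcases doubleCurrentMeasure_zero_or_prob G hβ A B with h | h
  · rw [h]; infer_instance
  · infer_instance

/-- The four-current law `P^{ab,∅}_{Λ_L} ⊗ P^{ce,∅}_{Λ_L}` is a finite measure. [cite: AizenmanDuminilCopinAnnals2021, §3.1] -/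
theorem isFiniteMeasure_fourCurrentLaw (L : ℕ) (a b c e : Site 3) :
    IsFiniteMeasure (fourCurrentLaw L a b c e) := by
  haveI := isFiniteMeasure_doubleCurrentMeasure (freeBoxGraph 3 L) (criticalBeta_nonneg 3)
    (boxSources 3 L ({a} ∆ {b})) ∅
  haveI := isFiniteMeasure_doubleCurrentMeasure (freeBoxGraph 3 L) (criticalBeta_nonneg 3)
    (boxSources 3 L ({c} ∆ {e})) ∅
  unfold fourCurrentLaw
  infer_instance

/-- **`fourTraceLaw = (fourCurrentLaw).map (sourcedTrace × sourcedTrace)`**: the pair of lifted traces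
`((n₁+n₂)^, (n₃+n₄)^)` of two independent sourced double currents is the image of the four-current law
(`sourcedDoubleCurrentLaw` is `(doubleCurrentMeasure …).map (sourcedTrace d L)` by definition; the product of two
push-forwards is the push-forward of the product, `Measure.map_prod_map`). [cite: AizenmanDuminilCopinAnnals2021, §3.1–3.2, eq. (3.13)] -/
theorem fourTraceLaw_eq_map (n : ℕ) (y : Fin 4 → Site 3) :
    fourTraceLaw n y =
      (fourCurrentLaw n (y 0) (y 1) (y 2) (y 3)).map (Prod.map (sourcedTrace 3 n) (sourcedTrace 3 n)) := by
  haveI := sFinite_doubleCurrentMeasure (freeBoxGraph 3 n) βc (boxSources 3 n ({y 0} ∆ {y 1})) ∅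
  haveI := sFinite_doubleCurrentMeasure (freeBoxGraph 3 n) βc (boxSources 3 n ({y 2} ∆ {y 3})) ∅
  rw [fourTraceLaw, fourCurrentLaw, sourcedDoubleCurrentLaw, sourcedDoubleCurrentLaw, boxSources_empty,
    Measure.map_prod_map _ _ (measurable_sourcedTrace n) (measurable_sourcedTrace n)]

/-! ## The meeting event and its pull-back -/

/-- **`Meet ⊆ FourMeet` after pull-back**: if the lifted traced clusters `C_{n₁+n₂}(y₀)` and `C_{n₃+n₄}(y₂)` share a
vertex `u`, then `y₀ ↔ u ↔ y₂` in the union of the four lifted traces, i.e. the four currents lie in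
`FourMeet n y₀ y₂` (`Current.traced_add`, `liftBonds_union`, monotonicity of `openGraph`).
[cite: AizenmanDuminilCopinAnnals2021, §4.2, proof of Lemma 4.4] -/
theorem preimage_meet_subset_fourMeet (n : ℕ) (y : Fin 4 → Site 3) :
    Prod.map (sourcedTrace 3 n) (sourcedTrace 3 n) ⁻¹' Meet y ⊆ FourMeet n (y 0) (y 2) := by
  rintro ⟨p, q⟩ ⟨u, hu₁, hu₂⟩
  have h₁ : (openGraph (sourcedTrace 3 n p)).Reachable (y 0) u := hu₁
  have h₂ : (openGraph (sourcedTrace 3 n q)).Reachable (y 2) u := hu₂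
  change (openGraph (liftBonds 3 n ((p.1 + p.2) + (q.1 + q.2)).traced)).Reachable (y 0) (y 2)
  rw [Current.traced_add, liftBonds_union]
  exact (h₁.mono (openGraph_mono Set.subset_union_left)).trans
    (h₂.mono (openGraph_mono Set.subset_union_right)).symm

/-! ## `meet ≤ fourCurrentMeet` -/

/-- `meet n y` as a four-current probability: `meet n y = (fourCurrentLaw n y₀ y₁ y₂ y₃).real (pull-back of Meet y)`.
[cite: AizenmanDuminilCopinAnnals2021, eq. (3.13)] -/
theorem meet_eq_fourCurrentLaw_real_preimage (n : ℕ) (y : Fin 4 → Site 3) :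
    meet n y = (fourCurrentLaw n (y 0) (y 1) (y 2) (y 3)).real
      (Prod.map (sourcedTrace 3 n) (sourcedTrace 3 n) ⁻¹' Meet y) := by
  -- `Meet y` is a countable union of products of connection events, hence measurable
  -- (same computation as `OnePinchDecayProof.measurableSet_meet` of the sibling dictionary of the line)
  have hmeas : MeasurableSet (Meet y) := by
    have h : Meet y = ⋃ u : Site 3, (openConn (y 0) u) ×ˢ (openConn (y 2) u) := by
      ext ω
      simp only [Meet, Set.mem_setOf_eq, Set.mem_iUnion, Set.mem_prod, openCluster, openConn]
    rw [h]
    exact MeasurableSet.iUnion fun u =>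
      (measurableSet_openConn_holds (y 0) u).prod (measurableSet_openConn_holds (y 2) u)
  rw [meet, fourTraceLaw_eq_map,
    map_measureReal_apply ((measurable_sourcedTrace n).prodMap (measurable_sourcedTrace n)) hmeas]

/-- **`meet ≤ P⁴`**: the line's duplicated hitting probability (the two lifted traced clusters share a vertex) is at
most the sibling crux's four-current gluing probability `fourCurrentMeet` (connection in the union of the four
traces), for every box size and every quadruple. [cite: AizenmanDuminilCopinAnnals2021, eq. (3.13) and §4.2] -/
theorem meet_le_fourCurrentMeet (n : ℕ) (y : Fin 4 → Site 3) :
    meet n y ≤ fourCurrentMeet n (y 0) (y 1) (y 2) (y 3) := by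
  haveI := isFiniteMeasure_fourCurrentLaw n (y 0) (y 1) (y 2) (y 3)
  rw [meet_eq_fourCurrentLaw_real_preimage, fourCurrentMeet]
  exact measureReal_mono (preimage_meet_subset_fourMeet n y) (measure_ne_top _ _)

/-- `meet n y ≤ 1` (`meet ≤ fourCurrentMeet ≤ 1`, `fourCurrentMeet_le_one`). [cite: AizenmanDuminilCopinAnnals2021, §3.1] -/
theorem meet_le_one (n : ℕ) (y : Fin 4 → Site 3) : meet n y ≤ 1 :=
  (meet_le_fourCurrentMeet n y).trans (fourCurrentMeet_le_one n _ _ _ _)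

/-! ## The box form of ADC21 (3.13): `merge ≤ meet` (Aizenman's disentangling, transported to the measures) -/

-- adapted from Theorems/IsingEuclidUpgradeR4NonGaussianSecondMomentBox.lean (`prod_apply_eq_tsum`, private there)
/-- The product measure of a set on countable discrete spaces, as a series over points. [folklore] -/
private theorem prod_apply_eq_tsum_singleton {α γ : Type*} [MeasurableSpace α] [MeasurableSpace γ]
    [Countable α] [Countable γ] [MeasurableSingletonClass α] [MeasurableSingletonClass γ]
    (μ : Measure α) (ν : Measure γ) [SFinite ν] (S : Set (α × γ)) :
    μ.prod ν S = ∑' pq : α × γ, μ {pq.1} * ν {pq.2} * S.indicator 1 pq := by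
  classical
  have hS : MeasurableSet S := S.to_countable.measurableSet
  rw [Measure.prod_apply hS, lintegral_countable', ENNReal.tsum_prod']
  refine tsum_congr fun p => ?_
  rw [← Measure.tsum_indicator_apply_singleton ν (Prod.mk p ⁻¹' S)
    (Set.to_countable _).measurableSet, ← ENNReal.tsum_mul_right]
  refine tsum_congr fun q => ?_
  by_cases h : (p, q) ∈ S
  · rw [Set.indicator_of_mem (show q ∈ Prod.mk p ⁻¹' S from h), Set.indicator_of_mem h,
      Pi.one_apply, mul_one, mul_comm]
  · rw [Set.indicator_of_notMem (show q ∉ Prod.mk p ⁻¹' S from h), Set.indicator_of_notMem h,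
      mul_zero, zero_mul]

/-- **Aizenman's disentangling (ADC21 (3.13)) for the double-current MEASURES of a finite graph** (uniform coupling
`β ≥ 0`, nondegenerate normalisers `Z[ab], Z[ce] ≠ 0`): for every set `S` of four-current configurations containing
all `(p, q)` whose clusters `C_{p₁+p₂}(a)`, `C_{q₁+q₂}(c)` share a vertex,
`P^{ab,ce}[a ↔ c in p₁+p₂] ≤ (P^{ab,∅} ⊗ P^{ce,∅})[S]` — the tree's un-normalised `Current.tsum_inter_pair_mul_sq_le_four`
divided by `Z[ab] Z[ce] Z[∅]²` (singleton masses `doubleCurrentMeasure_singleton_eq_div`, product measure as a series).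
[cite: AizenmanDuminilCopinAnnals2021, eq. (3.13) and Cor. A.2] [cite: Aizenman1982, Prop. 5.3] -/
theorem doubleCurrentMeasure_tracedConn_le_prod {V : Type*} [Fintype V] [DecidableEq V] (G : SimpleGraph V)
    [DecidableRel G.Adj] {β : ℝ} (hβ : 0 ≤ β) (a b c e : V)
    (hcA : currentSum G β ({a} ∆ {b}) ≠ 0) (hcB : currentSum G β ({c} ∆ {e}) ≠ 0)
    (S : Set ((Current G × Current G) × (Current G × Current G)))
    (hS : ∀ p q : Current G × Current G, ¬ Disjoint ((q.1 + q.2).cluster c) ((p.1 + p.2).cluster a) →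
      (p, q) ∈ S) :
    doubleCurrentMeasure G β ({a} ∆ {b}) ({c} ∆ {e}) (tracedConn G a c) ≤
      ((doubleCurrentMeasure G β ({a} ∆ {b}) ∅).prod (doubleCurrentMeasure G β ({c} ∆ {e}) ∅)) S := by
  set K : G.edgeFinset → ℝ := fun _ => β with hKdef
  have hK : ∀ e', 0 ≤ K e' := fun _ => hβ
  have hZtop : ∀ A, ecurrentSum K A ≠ ∞ := fun A => ecurrentSum_ne_top hK A
  have hZ0 : ecurrentSum K ∅ ≠ 0 := ecurrentSum_empty_ne_zero K
  have hZcs : ∀ A, ecurrentSum K A = ENNReal.ofReal (currentSum G β A) := fun A => by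
    rw [currentSum_eq_wcurrentSum, ecurrentSum_eq_ofReal hK]
  have hc0 : currentSum G β ∅ ≠ 0 := fun h => hZ0 (by rw [hZcs, h, ENNReal.ofReal_zero])
  -- (i) the merging mass `P^{ab,ce}[a ↔ c] = (∑ w w 𝟙[c ∈ C(a)]) / (Z[ab] Z[ce])`
  have hP2 : doubleCurrentMeasure G β ({a} ∆ {b}) ({c} ∆ {e}) (tracedConn G a c) =
      (∑' p : Current G × Current G, epairWeight K ({a} ∆ {b}) ({c} ∆ {e}) p *
        (if c ∈ (p.1 + p.2).cluster a then 1 else 0)) /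
        (ecurrentSum K ({a} ∆ {b}) * ecurrentSum K ({c} ∆ {e})) := by
    rw [doubleCurrentMeasure_apply_eq_tsum_epairWeight_div G β hβ _ _ hcA hcB]
    congr 1
    refine tsum_congr fun p => ?_
    by_cases hp : c ∈ (p.1 + p.2).cluster a
    · rw [if_pos hp, Set.indicator_of_mem (show p ∈ tracedConn G a c from Current.mem_cluster_iff.1 hp),
        Pi.one_apply]
    · rw [if_neg hp,
        Set.indicator_of_notMem (show p ∉ tracedConn G a c from fun h => hp (Current.mem_cluster_iff.2 h))]
  -- (ii) the four-current mass of `S` as a normalised series of pair weights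
  -- (same computation as `OnePinchDecayProof.prod_doubleCurrentMeasure_apply` of the sibling dictionary)
  have hZne : ∀ A, currentSum G β A ≠ 0 → ecurrentSum K A ≠ 0 := fun A hA h =>
    hA (by rw [hZcs] at h; exact le_antisymm (ENNReal.ofReal_eq_zero.1 h) (currentSum_nonneg _ hβ _))
  have hP4 : ((doubleCurrentMeasure G β ({a} ∆ {b}) ∅).prod (doubleCurrentMeasure G β ({c} ∆ {e}) ∅)) S =
      (∑' q, epairWeight K ({a} ∆ {b}) ∅ q.1 * epairWeight K ({c} ∆ {e}) ∅ q.2 * S.indicator 1 q) /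
        (ecurrentSum K ({a} ∆ {b}) * ecurrentSum K ∅ * (ecurrentSum K ({c} ∆ {e}) * ecurrentSum K ∅)) := by
    haveI := sFinite_doubleCurrentMeasure G β ({c} ∆ {e}) ∅
    rw [prod_apply_eq_tsum_singleton, div_eq_mul_inv, ← ENNReal.tsum_mul_right]
    refine tsum_congr fun q => ?_
    rw [doubleCurrentMeasure_singleton_eq_div G β hβ _ _ hcA hc0,
      doubleCurrentMeasure_singleton_eq_div G β hβ _ _ hcB hc0,
      ENNReal.mul_inv (Or.inl (mul_ne_zero (hZne _ hcA) hZ0))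
        (Or.inl (ENNReal.mul_ne_top (hZtop _) (hZtop _))), div_eq_mul_inv, div_eq_mul_inv]
    ring
  -- (iii) Aizenman's disentangling, un-normalised (tree), and the inclusion `{clusters meet} ⊆ S`
  have h313 := Current.tsum_inter_pair_mul_sq_le_four hK a b c e
  have hincl : ∀ p q : Current G × Current G,
      (if Disjoint ((q.1 + q.2).cluster c) ((p.1 + p.2).cluster a) then (0 : ℝ≥0∞) else 1) ≤
        S.indicator 1 (p, q) := by
    intro p q
    by_cases hdis : Disjoint ((q.1 + q.2).cluster c) ((p.1 + p.2).cluster a)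
    · rw [if_pos hdis]; exact bot_le
    · rw [if_neg hdis, Set.indicator_of_mem (hS p q hdis), Pi.one_apply]
  have hZZ0 : ecurrentSum K ∅ * ecurrentSum K ∅ ≠ 0 := mul_ne_zero hZ0 hZ0
  have hZZt : ecurrentSum K ∅ * ecurrentSum K ∅ ≠ ∞ := ENNReal.mul_ne_top (hZtop _) (hZtop _)
  -- (iv) the chain, in `ℝ≥0∞`
  rw [hP2, hP4]
  calc (∑' p : Current G × Current G, epairWeight K ({a} ∆ {b}) ({c} ∆ {e}) p *
        (if c ∈ (p.1 + p.2).cluster a then 1 else 0)) / (ecurrentSum K ({a} ∆ {b}) * ecurrentSum K ({c} ∆ {e}))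
      = (∑' p : Current G × Current G, epairWeight K ({a} ∆ {b}) ({c} ∆ {e}) p *
        (if c ∈ (p.1 + p.2).cluster a then 1 else 0)) * (ecurrentSum K ∅ * ecurrentSum K ∅) /
          (ecurrentSum K ({a} ∆ {b}) * ecurrentSum K ({c} ∆ {e}) * (ecurrentSum K ∅ * ecurrentSum K ∅)) :=
        (ENNReal.mul_div_mul_right _ _ hZZ0 hZZt).symm
    _ = (∑' p : Current G × Current G, epairWeight K ({a} ∆ {b}) ({c} ∆ {e}) p *
        (if c ∈ (p.1 + p.2).cluster a then 1 else 0)) * ecurrentSum K ∅ ^ 2 /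
          (ecurrentSum K ({a} ∆ {b}) * ecurrentSum K ∅ * (ecurrentSum K ({c} ∆ {e}) * ecurrentSum K ∅)) := by
        rw [sq]; congr 1; ring
    _ ≤ (∑' p, ∑' q, epairWeight K ({a} ∆ {b}) ∅ p * epairWeight K ({c} ∆ {e}) ∅ q *
          (if Disjoint ((q.1 + q.2).cluster c) ((p.1 + p.2).cluster a) then 0 else 1)) /
          (ecurrentSum K ({a} ∆ {b}) * ecurrentSum K ∅ * (ecurrentSum K ({c} ∆ {e}) * ecurrentSum K ∅)) :=
        ENNReal.div_le_div_right h313 _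
    _ ≤ (∑' p, ∑' q, epairWeight K ({a} ∆ {b}) ∅ p * epairWeight K ({c} ∆ {e}) ∅ q *
          S.indicator 1 (p, q)) /
          (ecurrentSum K ({a} ∆ {b}) * ecurrentSum K ∅ * (ecurrentSum K ({c} ∆ {e}) * ecurrentSum K ∅)) :=
        ENNReal.div_le_div_right (ENNReal.tsum_le_tsum fun p => ENNReal.tsum_le_tsum fun q =>
          mul_le_mul' le_rfl (hincl p q)) _
    _ = (∑' pq : (Current G × Current G) × (Current G × Current G),
          epairWeight K ({a} ∆ {b}) ∅ pq.1 * epairWeight K ({c} ∆ {e}) ∅ pq.2 * S.indicator 1 pq) /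
          (ecurrentSum K ({a} ∆ {b}) * ecurrentSum K ∅ * (ecurrentSum K ({c} ∆ {e}) * ecurrentSum K ∅)) := by
        congr 1
        exact (ENNReal.tsum_prod' (f := fun pq : (Current G × Current G) × (Current G × Current G) =>
          epairWeight K ({a} ∆ {b}) ∅ pq.1 * epairWeight K ({c} ∆ {e}) ∅ pq.2 * S.indicator 1 pq)).symm

/-- If the box clusters `C_{q₁+q₂}(c)` and `C_{p₁+p₂}(a)` share a box vertex, the pair of lifted traces lies in
`Meet y` (`↑a = y₀`, `↑c = y₂`; lift the two box paths with `reachable_liftBonds`). [cite: AizenmanDuminilCopinAnnals2021, eq. (3.13)] -/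
theorem mem_preimage_meet_of_not_disjoint {n : ℕ} {y : Fin 4 → Site 3} (a c : BoxVertex 3 n)
    (ha : (a : Site 3) = y 0) (hc : (c : Site 3) = y 2)
    (p q : Current (freeBoxGraph 3 n) × Current (freeBoxGraph 3 n))
    (h : ¬ Disjoint ((q.1 + q.2).cluster c) ((p.1 + p.2).cluster a)) :
    (p, q) ∈ Prod.map (sourcedTrace 3 n) (sourcedTrace 3 n) ⁻¹' Meet y := by
  obtain ⟨v, hvq, hvp⟩ := Finset.not_disjoint_iff.1 h
  refine ⟨(v : Site 3), ?_, ?_⟩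
  · change (openGraph (liftBonds 3 n (p.1 + p.2).traced)).Reachable (y 0) v
    rw [← ha]
    exact reachable_liftBonds 3 (Current.mem_cluster_iff.1 hvp)
  · change (openGraph (liftBonds 3 n (q.1 + q.2).traced)).Reachable (y 2) v
    rw [← hc]
    exact reachable_liftBonds 3 (Current.mem_cluster_iff.1 hvq)

/-- **ADC21 (3.13) in the box** (Aizenman 1982): for `y₀,…,y₃ ∈ Λ_{n+1}`, the two-current merging probability is at
most the duplicated hitting probability,
`P^{y₀y₁,y₂y₃}_{Λ_n}[y₀ ↔ y₂ in n₁+n₂] ≤ P^{y₀y₁,∅} ⊗ P^{y₂y₃,∅}_{Λ_n}[C_{n₁+n₂}(y₀) ∩ C_{n₃+n₄}(y₂) ≠ ∅]`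
(degenerate normalisers: the merging law is the zero measure). [cite: AizenmanDuminilCopinAnnals2021, eq. (3.13) and Cor. A.2] [cite: Aizenman1982, Prop. 5.3] -/
theorem merge_le_meet_of_mem_box_succ (n : ℕ) (y : Fin 4 → Site 3) (hy : ∀ i, y i ∈ box 3 (n + 1)) :
    merge n y ≤ meet n y := by
  have hβ : 0 ≤ criticalBeta 3 := criticalBeta_nonneg 3
  obtain ⟨a, ha⟩ : ∃ a : BoxVertex 3 n, (a : Site 3) = y 0 := ⟨⟨y 0, hy 0⟩, rfl⟩
  obtain ⟨b, hb⟩ : ∃ b : BoxVertex 3 n, (b : Site 3) = y 1 := ⟨⟨y 1, hy 1⟩, rfl⟩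
  obtain ⟨c, hc⟩ : ∃ c : BoxVertex 3 n, (c : Site 3) = y 2 := ⟨⟨y 2, hy 2⟩, rfl⟩
  obtain ⟨e, he⟩ : ∃ e : BoxVertex 3 n, (e : Site 3) = y 3 := ⟨⟨y 3, hy 3⟩, rfl⟩
  -- sources read in the box
  have hA : boxSources 3 n ({y 0} ∆ {y 1}) = ({a} : Finset (BoxVertex 3 n)) ∆ {b} := by
    rw [← ha, ← hb]; exact boxSources_pair 3 n a b
  have hB : boxSources 3 n ({y 2} ∆ {y 3}) = ({c} : Finset (BoxVertex 3 n)) ∆ {e} := by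
    rw [← hc, ← he]; exact boxSources_pair 3 n c e
  -- the merging probability, read on the currents
  have hmerge : merge n y = (doubleCurrentMeasure (freeBoxGraph 3 n) (criticalBeta 3) ({a} ∆ {b}) ({c} ∆ {e})
      (tracedConn (freeBoxGraph 3 n) a c)).toReal := by
    rw [merge_eq_twoCurrentMeet, twoCurrentMeet, measureReal_def,
      sourcedDoubleCurrentLaw_apply _ _ _ _ (measurableSet_openConn_holds (y 0) (y 2)), hA, hB, ← ha, ← hc,
      sourcedTrace_preimage_openConn]
  -- the duplicated hitting probability, read on the four currents
  have hmeet : meet n y = ((doubleCurrentMeasure (freeBoxGraph 3 n) (criticalBeta 3) ({a} ∆ {b}) ∅).prod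
      (doubleCurrentMeasure (freeBoxGraph 3 n) (criticalBeta 3) ({c} ∆ {e}) ∅)
        (Prod.map (sourcedTrace 3 n) (sourcedTrace 3 n) ⁻¹' Meet y)).toReal := by
    rw [meet_eq_fourCurrentLaw_real_preimage, measureReal_def, fourCurrentLaw, hA, hB]
  by_cases hdeg : currentSum (freeBoxGraph 3 n) (criticalBeta 3) ({a} ∆ {b}) *
      currentSum (freeBoxGraph 3 n) (criticalBeta 3) ({c} ∆ {e}) = 0
  · -- degenerate normalisers: the merging law is the zero measure
    have h0 : doubleCurrentMeasure (freeBoxGraph 3 n) (criticalBeta 3) ({a} ∆ {b}) ({c} ∆ {e}) = 0 := by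
      simp [doubleCurrentMeasure, hdeg]
    rw [hmerge, h0, Measure.coe_zero, Pi.zero_apply, ENNReal.toReal_zero]
    exact measureReal_nonneg
  · obtain ⟨hcA, hcB⟩ := mul_ne_zero_iff.1 hdeg
    haveI := isFiniteMeasure_doubleCurrentMeasure (freeBoxGraph 3 n) hβ ({a} ∆ {b}) ∅
    haveI := isFiniteMeasure_doubleCurrentMeasure (freeBoxGraph 3 n) hβ ({c} ∆ {e}) ∅
    rw [hmerge, hmeet]
    exact ENNReal.toReal_mono (measure_ne_top _ _)
      (doubleCurrentMeasure_tracedConn_le_prod (freeBoxGraph 3 n) hβ a b c e hcA hcB _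
        fun p q hpq => mem_preimage_meet_of_not_disjoint a c ha hc p q hpq)

end FourToTwoProof

open FourToTwoProof
open Literature.Probability.LatticeModels
open Summit.CriticalPhenomena.Ising3DConformalLimit.GapForcesFarMergingSandwich
open Summit.CriticalPhenomena.Ising3DConformalLimit.Cruxes.IsingEuclidUpgradeR4NonGaussian.FreeCovarianceDeltaDichotomy

/-- **Registered helper `fourToTwo_dictionary`** (for `stub_fourToTwoMerging`, line `one-cluster-depletion-sandwich`):
the line's `merge` IS the sibling crux's `twoCurrentMeet` (ADC21 (3.11)); the line's duplicated hitting `meet` is at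
most the sibling crux's `fourCurrentMeet` (the objects of ADC21 (3.13)) and at most `1`, for every box size `n` and
every quadruple `y`. [cite: AizenmanDuminilCopinAnnals2021, eq. (3.11) and (3.13)] -/
theorem fourToTwo_dictionary : ∀ (n : ℕ) (y : Fin 4 → Site 3), merge n y = twoCurrentMeet n (y 0) (y 1) (y 2) (y 3) ∧ meet n y ≤ fourCurrentMeet n (y 0) (y 1) (y 2) (y 3) ∧ meet n y ≤ 1 :=
  fun n y => ⟨merge_eq_twoCurrentMeet n y, meet_le_fourCurrentMeet n y, meet_le_one n y⟩

/-- **Registered helper `merge_le_meet_box`** (for `stub_fourToTwoMerging`, line `one-cluster-depletion-sandwich`):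
ADC21 (3.13) in the free box `Λ_n` at `β_c(3)` — for `y₀,…,y₃ ∈ Λ_{n+1}` the two-current merging probability
`merge n y` is at most the duplicated hitting probability `meet n y`.
[cite: AizenmanDuminilCopinAnnals2021, eq. (3.13) and Cor. A.2] [cite: Aizenman1982, Prop. 5.3] -/
theorem merge_le_meet_box : ∀ (n : ℕ) (y : Fin 4 → Site 3), (∀ i, y i ∈ box 3 (n + 1)) → merge n y ≤ meet n y :=
  fun n y hy => merge_le_meet_of_mem_box_succ n y hy

/-- **Registered helper `farHitIO_of_farMergeIO` — the CONVERSE of the stub `stub_fourToTwoMerging` is a theorem**: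
far two-current merging along dilations of a shape forces far duplicated hitting along the same dilations, with the
same constant (ADC21 (3.13) in the box, once the box contains the dilated shape). The stub asks for the reverse,
single-versus-duplicated (fatness) implication. [cite: AizenmanDuminilCopinAnnals2021, eq. (3.13)] -/
theorem farHitIO_of_farMergeIO : FarMergeIO → FarHitIO := by
  rintro ⟨c, hc, y, hy, hio⟩
  refine ⟨c, hc, y, hy, fun L₀ => ?_⟩
  obtain ⟨L, hL, hfreq⟩ := hio L₀
  obtain ⟨n₀, hn₀⟩ := exists_forall_subset_box 3 (Finset.univ.image fun i => (L : ℤ) • y i)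
  refine ⟨L, hL, (hfreq.and_eventually (Filter.eventually_ge_atTop n₀)).mono fun n hn => hn.1.trans ?_⟩
  exact merge_le_meet_box n _ fun i =>
    box_subset_box_succ 3 n (hn₀ n hn.2 (Finset.mem_image_of_mem _ (Finset.mem_univ i)))

end Summit.CriticalPhenomena.Ising3DConformalLimit.EnergyNotSigmaSquaredGapForcesFarMergingSandwich

end
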